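import Mathlib
import Summits.Ventures.PercRepro2.Defs
import Summits.Ventures.PercRepro2.Harris
import Summits.Ventures.PercRepro2.CoinDefs
import Summits.Ventures.PercRepro2.CoinReverse
import Summits.Ventures.PercRepro2.CoinPendantDefs
import Summits.Ventures.PercRepro2.CoinTraceLevels
import Summits.Ventures.PercRepro2.CoinForestLaw
import Summits.Ventures.PercRepro2.CoinLsmCoreAlg
import Summits.Ventures.PercRepro2.CoinLsmCoreDefs
import Summits.Ventures.PercRepro2.CoinLsmCore

/-!
# Row 2′DARC over an OUT-TREE CORE at EVERY head (blind cell PercRepro2, night-2 g7;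
proofs/NIGHT2-DARC.md §30.10)

An out-tree core: each `v ∈ C` is entered by exactly one single-arc coin `c v = {par v → v}` from
its parent `par v ∈ C ∪ {s}` (acyclic: a rank), the tree coins are the only coins with an arc into
`C`, nothing enters `s`.  It is a closed-in core whose core levels are the trace levels of a
pendant forest below `s` in the REVERSED system, so the cluster law is log-supermodular
(`forest_trace_lsm`), and `darc_of_lsmCore` applies: **row 2′DARC holds at `u → w` for every head**
(`darc_of_treeCore`); `u` may be an ancestor of `a` or `b` (e.g. the chain `s → u → a`).
-/

namespace Summit.Ventures.PercRepro2.Coin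

open Classical

section TreeCore

variable {V : Type*} {E : Type*} [DecidableEq V]

/-- An out-tree core: `c v = {par v → v}` (`v ∈ C`, `par v ∈ C ∪ {s}`, acyclic by a rank), the
tree coins are the only coins with an arc into `C`, no arc enters `s`, `s ∉ C`. -/
structure TreeCore (arcs : E → Finset (V × V)) (s : V) (C : Finset V) (c : V → E) (par : V → V)
    (rk : V → ℕ) : Prop where
  tree : ∀ v ∈ C, arcs (c v) = {(par v, v)}
  par_mem : ∀ v ∈ C, par v ∈ C ∨ par v = s
  rank : ∀ v ∈ C, par v ∈ C → rk (par v) < rk v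
  into_C : ∀ e, ∀ xy ∈ arcs e, xy.2 ∈ C → ∃ v ∈ C, e = c v
  into_s : ∀ e, ∀ xy ∈ arcs e, xy.2 ≠ s
  s_notin : s ∉ C

variable {arcs : E → Finset (V × V)} {s : V} {C : Finset V} {c : V → E} {par : V → V}
  {rk : V → ℕ}

omit [DecidableEq V] in
/-- A tree core is a closed-in core. -/
lemma TreeCore.closedInCore (h : TreeCore arcs s C c par rk) : ClosedInCore arcs s C where
  into_C := by
    intro e xy hxy hy
    obtain ⟨v, hv, rfl⟩ := h.into_C e xy hxy hy
    rw [h.tree v hv, Finset.mem_singleton] at hxy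
    rw [hxy]
    exact h.par_mem v hv
  into_s := h.into_s
  s_notin := h.s_notin

/-- In the reversed system the tree coins are the forest coins `{v → par v}`. -/
lemma TreeCore.revArcs_tree (h : TreeCore arcs s C c par rk) {v : V} (hv : v ∈ C) :
    revArcs arcs (c v) = {(v, par v)} := by
  simp only [revArcs, h.tree v hv, Finset.image_singleton, Prod.swap_prod_mk]

/-- The coins with an arc into `C` are the tree coins. -/
lemma TreeCore.honly_rev (h : TreeCore arcs s C c par rk) :
    ∀ e, (∃ xy ∈ revArcs arcs e, xy.1 ∈ C) → ∃ v ∈ C, e = c v := by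
  rintro e ⟨xy, hxy, hx⟩
  rw [mem_revArcs] at hxy
  exact h.into_C e _ hxy hx

end TreeCore

section TreeMain

variable {V : Type*} {E : Type*} [Fintype V] [DecidableEq V] [Fintype E] [DecidableEq E]
  {R : Type*} [Field R] [LinearOrder R] [IsStrictOrderedRing R]
  {arcs : E → Finset (V × V)} {s : V} {C : Finset V} {c : V → E} {par : V → V} {rk : V → ℕ}

omit [Fintype V] in
/-- **The cluster law of an out-tree core is log-supermodular** (`forest_trace_lsm` in the reversed
system, target `s`). -/
theorem TreeCore.coreLevel_lsm (h : TreeCore arcs s C c par rk) (p : E → R) (hp : IsProbVec p) :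
    ∀ W W', W ⊆ C → W' ⊆ C →
      prob p (coreLevel arcs s C W) * prob p (coreLevel arcs s C W') ≤
        prob p (coreLevel arcs s C (W ∩ W')) * prob p (coreLevel arcs s C (W ∪ W')) := by
  intro W W' hW hW'
  unfold coreLevel
  exact forest_trace_lsm p hp h.s_notin (fun v hv => h.revArcs_tree hv) h.par_mem h.honly_rev
    h.rank W W' hW hW'

/-- **THEOREM (row 2′DARC over an out-tree core, every head).**  `TreeCore arcs s C c par rk`,
`SameEnds`, `a, b, u ∈ C`, `w ∉ C ∪ {s}`, `t ∉ C ∪ {s}`, the two cell masses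
`M₀ = Σ_{W ∌ u} P(level W) · P(W ∪ {s} ↛ t)`, `M' = Σ_{W ∋ u} P(level W) · P(W ∪ {s, w} ↛ t)`
(reachability without the tree coins) positive ⟹ `Φ_D({s ↛ t in D + (u → w)}) ≥ 0`.  The
structure beyond the core is arbitrary; `u` may lie on the tree paths to `a` and `b`. -/
theorem darc_of_treeCore (p : E → R) (hp : IsProbVec p) (hS : SameEnds arcs)
    (h : TreeCore arcs s C c par rk) {t : V} (htC : t ∉ C) (hts : t ≠ s) {a b u w : V}
    (ha : a ∈ C) (hb : b ∈ C) (hu : u ∈ C) (hws : w ≠ s) (hwC : w ∉ C)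
    (hM₀ : 0 < ∑ W ∈ C.powerset, prob p (coreLevel arcs s C W) * notMemWt u W *
      prob p (coreAvoidEvent arcs s t C W))
    (hM' : 0 < ∑ W ∈ C.powerset, prob p (coreLevel arcs s C W) * memWt u W *
      prob p (coreAvoidEvent arcs s t C (insert w W))) :
    DARC p arcs s {t} a b u w :=
  darc_of_lsmCore p hp hS h.closedInCore htC hts ha hb hu hws hwC (h.coreLevel_lsm p hp) hM₀ hM'

end TreeMain

end Summit.Ventures.PercRepro2.Coin
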